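import Mathlib
import HarnessLib
import Literature.Probability.MarkovChains.MetropolisHastings

/-!
# The exchange algorithm (Murray–Ghahramani–MacKay): exact Metropolis–Hastings for targets with an
# intractable normalising function, using ONE exact auxiliary draw from the proposed parameter

Topic `Probability/MarkovChains`.  PUBLISHED RESULT with our formalisation of the printed proof; no
named fact is introduced (the kernel is a definition with a body; everything else is a theorem).
Sequel of `MetropolisHastings.lean` (the tree's `DetailedBalance` / `IsStationary` vocabulary and the
exact kernel `mhKernel`) and companion of `PseudoMarginal.lean` / `PenaltyMethod.lean` /
`BernoulliFactoryBarker.lean` (the other EXACT randomised-acceptance schemes of the tree).  Wanted by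
the cell pub-lqcd (venture `LatticeQCDFlow`, HOME/R2-SCOPE.md §3 E2 "the determinant enters exactly —
admissible classes": class D1 is the Knechtli–Wolff / Albergo-et-al. scheme in which ONE auxiliary
pseudofermion is drawn from the CURRENT state's conditional and shared by numerator and denominator of
the acceptance ratio; the exchange algorithm is the mirror scheme — the auxiliary is drawn from the
PROPOSED state's conditional — and is exact for the same reason (the joint flux through a fixed
auxiliary value is symmetric); the fermion weight `e^{−S_g(U)} det(D†D)(U) = e^{−S_g(U)}/𝒵(U)` with
`𝒵(U) = ∫ e^{−|D(U)φ|²} dφ/π^N` is a "doubly-intractable" target in the sense of the source, whose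
auxiliary law `e^{−|D(U)φ|²}/𝒵(U)` is sampled exactly by one solve `φ = D(U)⁻¹η`; FANOUT row 38).

## Source and the printed statement

I. Murray, Z. Ghahramani, D. J. C. MacKay, *MCMC for doubly-intractable distributions*, Proc. 22nd
Conference on Uncertainty in Artificial Intelligence (UAI 2006), 359–366 = arXiv:1206.6848
[MurrayGhahramaniMacKay2006], §3 "The exchange algorithm" (materialised text `paper:arxiv-1206.6848`,
chunks p0008–p0009).  Setting (§1, eqs. (1)–(4)): a likelihood `p(y|θ) = f(y; θ)/Z(θ)` with an
intractable `Z(θ) = Σ_y f(y; θ)`, a prior `p(θ)`, the posterior `p(θ|y) ∝ p(θ) f(y; θ)/Z(θ)`, a proposal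
`q(θ′; θ, y)`.

> **Single-variable Exchange algorithm.** Input: initial `θ`, number of iterations `T`.
> 1. for `t = 1 … T`  2. Propose `θ′ ∼ q(θ′; θ, y)`  3. generate an auxiliary variable,
> `w ∼ f(w; θ′)/Z(θ′)`  4. Compute
> `a = q(θ; θ′, y) p(θ′) f(y; θ′) f(w; θ) / (q(θ′; θ, y) p(θ) f(y; θ) f(w; θ′))` (22)
> 5. Draw `r ∼ Uniform[0, 1]`  6. if (`r < a`) then set `θ = θ′`.  7. end for
> … The exchange algorithm is a valid MCMC method because it is the M-H algorithm for a joint system with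
> the correct posterior distribution `p(θᵢ|y)`.  We now outline a more direct mathematical proof … It is
> easily shown that detailed balance holds for any particular intermediate exact sample `w` by checking
> that the probability of starting at `θᵢ` (under the intended equilibrium distribution `p(θᵢ|y)`) and
> then moving to `θⱼ` via the exact sample `w` is symmetric in `i` and `j`.  Summing over the
> intermediate quantity `w` gives detailed balance overall.

## What is proved (finite parameter set `Θ`, finite data space `W`; real weights)

For `f : Θ → W → ℝ` with `f ≥ 0` and `Z θ = Σ_w f θ w > 0`, a prior `p ≥ 0`, observed data `y`, a
proposal `q ≥ 0` (no normalisation is needed for detailed balance; row-stochasticity of the kernel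
holds by construction of its diagonal):

* `flux` — the probability flux `p(θ|y)·q(θ′;θ)·[f(w;θ′)/Z(θ′)]·min(1, a(θ,θ′,w))` through a fixed
  auxiliary value `w`; `flux_eq_min` — it equals `min(D, N)/(Z(θ)Z(θ′))` with `D, N` the denominator
  and numerator of (22); **`flux_symm`** — it is symmetric in `(θ, θ′)` ("detailed balance holds for
  any particular intermediate exact sample `w`"); stated with the UNNORMALISED posterior weight
  `postWeight θ = p θ · f θ y / Z θ` (the normalising constant of the posterior is a common factor);
  Lean's `x / 0 = 0` makes the degenerate branches (zero proposal or prior mass) agree on both sides,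
  so only NONNEGATIVITY of `p, q, f` and `Z > 0` are assumed;
* `kernel` — the transition matrix of steps 2–6 (off-diagonal `rate θ θ′ = q(θ′;θ) · E_w[min(1,a)]`;
  diagonal: the remaining mass), **`kernel_detailedBalance`** ("summing over `w` gives detailed balance
  overall"), `kernel_sum_eq_one`, and **`kernel_isStationary`**: the posterior `p(θ|y)` is stationary
  — the algorithm is exact although `Z` is never evaluated;
* `rate_le` — the move probability never exceeds the proposal probability (it is a randomised
  thinning of `q`), `rate_nonneg`, and `kernel_nonneg` (a Markov kernel when `q` is sub-stochastic off
  the diagonal).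

Scope (honest): finite spaces and one exact auxiliary draw per step (the "single-variable" algorithm;
the bridged variant of §3.1 with `K` annealing levels is not treated); nothing about efficiency
(acceptance rates, comparison with SAVM/MAVM, §5) is formalised.

## References

* [MurrayGhahramaniMacKay2006] I. Murray, Z. Ghahramani, D. J. C. MacKay, MCMC for doubly-intractable
  distributions, UAI 2006, §3, Algorithm "Single-variable Exchange algorithm", eq. (22).
-/

noncomputable section

namespace Literature.Probability.MarkovChains

namespace ExchangeAlgorithm

open Finset

variable {Θ W : Type*} [Fintype Θ] [DecidableEq Θ] [Fintype W]

/-- The normalising function `Z(θ) = Σ_w f(w; θ)` of the unnormalised likelihood.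
[cite: MurrayGhahramaniMacKay2006, §1 eq. (2)] -/
def Z (f : Θ → W → ℝ) (θ : Θ) : ℝ := ∑ w, f θ w

/-- The (unnormalised) posterior weight `p(θ) f(y; θ)/Z(θ)` of the doubly-intractable target
`p(θ|y) = p(y|θ)p(θ)/p(y)`, `p(y|θ) = f(y; θ)/Z(θ)`. [cite: MurrayGhahramaniMacKay2006, §1 eqs. (1), (3)] -/
def postWeight (f : Θ → W → ℝ) (p : Θ → ℝ) (y : W) (θ : Θ) : ℝ := p θ * f θ y / Z f θ

/-- The exchange acceptance ratio (22):
`a = q(θ; θ′) p(θ′) f(y; θ′) f(w; θ) / (q(θ′; θ) p(θ) f(y; θ) f(w; θ′))` — no `Z` appears.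
(`q θ θ′` is the probability of proposing `θ′` from `θ`; the dependence of `q` on `y` is suppressed.)
[cite: MurrayGhahramaniMacKay2006, §3 eq. (22)] -/
def ratio (f : Θ → W → ℝ) (p : Θ → ℝ) (q : Θ → Θ → ℝ) (y : W) (θ θ' : Θ) (w : W) : ℝ :=
  q θ' θ * p θ' * f θ' y * f θ w / (q θ θ' * p θ * f θ y * f θ' w)

/-- The off-diagonal move probability of one exchange step from `θ` to `θ′ ≠ θ`: propose `θ′`
(probability `q θ θ′`), draw `w ∼ f(·; θ′)/Z(θ′)`, accept with probability `min(1, a)` — averaged over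
`w`. [cite: MurrayGhahramaniMacKay2006, §3 (Algorithm, steps 2–6)] -/
def rate (f : Θ → W → ℝ) (p : Θ → ℝ) (q : Θ → Θ → ℝ) (y : W) (θ θ' : Θ) : ℝ :=
  q θ θ' * ∑ w, f θ' w / Z f θ' * min 1 (ratio f p q y θ θ' w)

/-- The transition matrix of the exchange algorithm (diagonal = rejected + self-proposed mass).
[cite: MurrayGhahramaniMacKay2006, §3 (Algorithm)] -/
def kernel (f : Θ → W → ℝ) (p : Θ → ℝ) (q : Θ → Θ → ℝ) (y : W) (θ θ' : Θ) : ℝ :=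
  if θ' = θ then 1 - ∑ z ∈ univ.erase θ, rate f p q y θ z else rate f p q y θ θ'

/-- The probability flux from `θ` to `θ′` THROUGH a fixed auxiliary value `w`:
`p(θ|y) · q(θ′; θ) · f(w; θ′)/Z(θ′) · min(1, a(θ, θ′, w))` (with the unnormalised posterior weight).
[cite: MurrayGhahramaniMacKay2006, §3 (proof outline: "the probability of starting at θᵢ … and then
moving to θⱼ via the exact sample w")] -/
def flux (f : Θ → W → ℝ) (p : Θ → ℝ) (q : Θ → Θ → ℝ) (y : W) (θ θ' : Θ) (w : W) : ℝ :=
  postWeight f p y θ * (q θ θ' * (f θ' w / Z f θ' * min 1 (ratio f p q y θ θ' w)))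

variable {f : Θ → W → ℝ} {p : Θ → ℝ} {q : Θ → Θ → ℝ} {y : W}

omit [Fintype Θ] [DecidableEq Θ] in
/-- `Z(θ) > 0` as soon as `f ≥ 0` and some `f(w; θ) > 0`. [folklore]
[cite: MurrayGhahramaniMacKay2006, §1 eq. (2) (the normalising function Z(θ))] -/
theorem Z_pos (hf : ∀ θ w, 0 ≤ f θ w) {θ : Θ} (h : ∃ w, 0 < f θ w) : 0 < Z f θ := by
  obtain ⟨w, hw⟩ := h
  exact lt_of_lt_of_le hw (single_le_sum (fun w' _ => hf θ w') (mem_univ w))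

omit [Fintype Θ] [DecidableEq Θ] [Fintype W] in
/-- The acceptance ratio (22) is nonnegative for nonnegative data. [folklore] -/
private theorem ratio_nonneg (hf : ∀ θ w, 0 ≤ f θ w) (hp : ∀ θ, 0 ≤ p θ) (hq : ∀ θ θ', 0 ≤ q θ θ')
    (θ θ' : Θ) (w : W) : 0 ≤ ratio f p q y θ θ' w :=
  div_nonneg (mul_nonneg (mul_nonneg (mul_nonneg (hq _ _) (hp _)) (hf _ _)) (hf _ _))
    (mul_nonneg (mul_nonneg (mul_nonneg (hq _ _) (hp _)) (hf _ _)) (hf _ _))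

omit [Fintype Θ] [DecidableEq Θ] in
/-- Key computation: for nonnegative data the flux through `w` is
`min(D, N)/(Z(θ) Z(θ′))` with `D = q(θ′;θ) p(θ) f(y;θ) f(w;θ′)` and `N = q(θ;θ′) p(θ′) f(y;θ′) f(w;θ)` the
denominator and numerator of (22) — including the degenerate case `D = 0` (then both sides vanish).
[cite: MurrayGhahramaniMacKay2006, §3 eq. (22) and proof outline] -/
theorem flux_eq_min (hf : ∀ θ w, 0 ≤ f θ w) (hp : ∀ θ, 0 ≤ p θ) (hq : ∀ θ θ', 0 ≤ q θ θ')
    (hZ : ∀ θ, 0 < Z f θ) (θ θ' : Θ) (w : W) :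
    flux f p q y θ θ' w =
      min (q θ θ' * p θ * f θ y * f θ' w) (q θ' θ * p θ' * f θ' y * f θ w) / (Z f θ * Z f θ') := by
  have hD0 : 0 ≤ q θ θ' * p θ * f θ y * f θ' w :=
    mul_nonneg (mul_nonneg (mul_nonneg (hq _ _) (hp _)) (hf _ _)) (hf _ _)
  have hN0 : 0 ≤ q θ' θ * p θ' * f θ' y * f θ w :=
    mul_nonneg (mul_nonneg (mul_nonneg (hq _ _) (hp _)) (hf _ _)) (hf _ _)
  have hZZ : Z f θ * Z f θ' ≠ 0 := (mul_pos (hZ θ) (hZ θ')).ne'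
  have hflux : flux f p q y θ θ' w =
      q θ θ' * p θ * f θ y * f θ' w / (Z f θ * Z f θ') * min 1 (ratio f p q y θ θ' w) := by
    simp only [flux, postWeight]
    ring
  rw [hflux]
  simp only [ratio]
  generalize q θ θ' * p θ * f θ y * f θ' w = D at hD0 ⊢
  generalize q θ' θ * p θ' * f θ' y * f θ w = N at hN0 ⊢
  rcases hD0.eq_or_lt with hD00 | hDpos
  · -- degenerate branch: the flux prefactor vanishes and so does `min D N`
    rw [← hD00, zero_div, zero_mul, min_eq_left hN0, zero_div]
  · have hDne : D ≠ 0 := hDpos.ne'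
    rw [show (1 : ℝ) = D / D from (div_self hDne).symm, min_div_div_right hDpos.le,
      div_mul_div_comm, mul_comm D (min D N), mul_div_mul_right _ _ hDne]

omit [Fintype Θ] [DecidableEq Θ] in
/-- **"Detailed balance holds for any particular intermediate exact sample `w`"**: the flux through
`w` is symmetric in `(θ, θ′)`. [cite: MurrayGhahramaniMacKay2006, §3 (proof outline)] -/
theorem flux_symm (hf : ∀ θ w, 0 ≤ f θ w) (hp : ∀ θ, 0 ≤ p θ) (hq : ∀ θ θ', 0 ≤ q θ θ')
    (hZ : ∀ θ, 0 < Z f θ) (θ θ' : Θ) (w : W) :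
    flux f p q y θ θ' w = flux f p q y θ' θ w := by
  rw [flux_eq_min hf hp hq hZ, flux_eq_min hf hp hq hZ, min_comm, mul_comm (Z f θ)]

omit [Fintype Θ] [DecidableEq Θ] in
/-- `p(θ|y) · rate(θ → θ′) = Σ_w flux(θ → θ′; w)`. [cite: MurrayGhahramaniMacKay2006, §3 (Algorithm)] -/
theorem postWeight_mul_rate (θ θ' : Θ) :
    postWeight f p y θ * rate f p q y θ θ' = ∑ w, flux f p q y θ θ' w := by
  simp only [rate, flux, mul_sum]

/-- Off-diagonal entries of the kernel are the rates. [folklore]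
[cite: MurrayGhahramaniMacKay2006, §3 (Algorithm, steps 2–6)] -/
theorem kernel_of_ne {θ θ' : Θ} (h : θ' ≠ θ) : kernel f p q y θ θ' = rate f p q y θ θ' := if_neg h

/-- Diagonal entry of the kernel (rejected + self-proposed mass). [folklore]
[cite: MurrayGhahramaniMacKay2006, §3 (Algorithm, step 6: otherwise θ is kept)] -/
theorem kernel_self (θ : Θ) : kernel f p q y θ θ = 1 - ∑ z ∈ univ.erase θ, rate f p q y θ z :=
  if_pos rfl

/-- **"Summing over the intermediate quantity `w` gives detailed balance overall"**: the posterior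
weight `p(θ) f(y;θ)/Z(θ)` is in detailed balance with the exchange kernel, for every nonnegative
`f, p, q` with `Z > 0` — although the kernel never evaluates `Z`.
[cite: MurrayGhahramaniMacKay2006, §3 ("The exchange algorithm is a valid MCMC method …")] -/
theorem kernel_detailedBalance (hf : ∀ θ w, 0 ≤ f θ w) (hp : ∀ θ, 0 ≤ p θ)
    (hq : ∀ θ θ', 0 ≤ q θ θ') (hZ : ∀ θ, 0 < Z f θ) :
    DetailedBalance (postWeight f p y) (kernel f p q y) := by
  intro θ θ'
  by_cases h : θ' = θ
  · subst h; rfl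
  · rw [kernel_of_ne h, kernel_of_ne (Ne.symm h), postWeight_mul_rate, postWeight_mul_rate]
    exact sum_congr rfl fun w _ => flux_symm hf hp hq hZ θ θ' w

/-- Rows of the exchange kernel sum to one. [folklore]
[cite: MurrayGhahramaniMacKay2006, §3 (Algorithm)] -/
theorem kernel_sum_eq_one (θ : Θ) : ∑ θ', kernel f p q y θ θ' = 1 := by
  rw [← add_sum_erase _ _ (mem_univ θ), kernel_self]
  have : ∑ θ' ∈ univ.erase θ, kernel f p q y θ θ' = ∑ θ' ∈ univ.erase θ, rate f p q y θ θ' :=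
    sum_congr rfl fun θ' hθ' => kernel_of_ne (ne_of_mem_erase hθ')
  rw [this]
  ring

/-- **The exchange algorithm is exact**: the doubly-intractable posterior `p(θ|y) ∝ p(θ)f(y;θ)/Z(θ)`
is a stationary distribution of the exchange kernel.
[cite: MurrayGhahramaniMacKay2006, §3 ("a valid MCMC method … with the correct posterior distribution")] -/
theorem kernel_isStationary (hf : ∀ θ w, 0 ≤ f θ w) (hp : ∀ θ, 0 ≤ p θ)
    (hq : ∀ θ θ', 0 ≤ q θ θ') (hZ : ∀ θ, 0 < Z f θ) :
    IsStationary (postWeight f p y) (kernel f p q y) :=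
  (kernel_detailedBalance hf hp hq hZ).isStationary kernel_sum_eq_one

omit [Fintype Θ] [DecidableEq Θ] in
/-- The move probability is a thinning of the proposal: `rate(θ → θ′) ≤ q(θ′; θ)` (the auxiliary law
`f(·;θ′)/Z(θ′)` is a probability vector and `min(1, a) ≤ 1`). [folklore]
[cite: MurrayGhahramaniMacKay2006, §3 (Algorithm, steps 2–6)] -/
theorem rate_le (hf : ∀ θ w, 0 ≤ f θ w) (hq : ∀ θ θ', 0 ≤ q θ θ') (hZ : ∀ θ, 0 < Z f θ)
    (θ θ' : Θ) : rate f p q y θ θ' ≤ q θ θ' := by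
  unfold rate
  have hsum : ∑ w, f θ' w / Z f θ' * min 1 (ratio f p q y θ θ' w) ≤ 1 := by
    calc ∑ w, f θ' w / Z f θ' * min 1 (ratio f p q y θ θ' w)
        ≤ ∑ w, f θ' w / Z f θ' := sum_le_sum fun w _ =>
          mul_le_of_le_one_right (div_nonneg (hf θ' w) (hZ θ').le) (min_le_left _ _)
      _ = 1 := by rw [← sum_div, div_eq_one_iff_eq (hZ θ').ne']; rfl
  exact mul_le_of_le_one_right (hq θ θ') hsum

omit [Fintype Θ] [DecidableEq Θ] in
/-- The move probability is nonnegative. [folklore]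
[cite: MurrayGhahramaniMacKay2006, §3 (Algorithm, steps 2–6)] -/
theorem rate_nonneg (hf : ∀ θ w, 0 ≤ f θ w) (hp : ∀ θ, 0 ≤ p θ) (hq : ∀ θ θ', 0 ≤ q θ θ')
    (hZ : ∀ θ, 0 < Z f θ) (θ θ' : Θ) : 0 ≤ rate f p q y θ θ' := by
  unfold rate
  refine mul_nonneg (hq θ θ') (sum_nonneg fun w _ => mul_nonneg (div_nonneg (hf θ' w) (hZ θ').le) ?_)
  exact le_min zero_le_one (ratio_nonneg hf hp hq θ θ' w)

/-- **The exchange kernel is a Markov kernel** when the proposal is sub-stochastic off the diagonal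
(`Σ_{θ′ ≠ θ} q(θ′; θ) ≤ 1`): all entries are nonnegative (and rows sum to one, `kernel_sum_eq_one`).
[cite: MurrayGhahramaniMacKay2006, §3 (Algorithm)] -/
theorem kernel_nonneg (hf : ∀ θ w, 0 ≤ f θ w) (hp : ∀ θ, 0 ≤ p θ) (hq : ∀ θ θ', 0 ≤ q θ θ')
    (hq1 : ∀ θ, ∑ θ' ∈ univ.erase θ, q θ θ' ≤ 1) (hZ : ∀ θ, 0 < Z f θ) (θ θ' : Θ) :
    0 ≤ kernel f p q y θ θ' := by
  by_cases h : θ' = θ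
  · rw [h, kernel_self, sub_nonneg]
    exact (sum_le_sum fun z _ => rate_le hf hq hZ θ z).trans (hq1 θ)
  · rw [kernel_of_ne h]
    exact rate_nonneg hf hp hq hZ θ θ'

end ExchangeAlgorithm

end Literature.Probability.MarkovChains

end
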